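import Summits.RiemannHypothesis.RiemannHypothesis.Theorems.ThetaTier2RowSound
import HarnessLib

/-!
# THETA tier-2 kernel rows — twin primes `5849 ≤ q ≤ 6761` (module 9 of 13; cc-s2-1, WEIL typing lane; RH-FREE bookkeeping)

Data module of the tier-2 theta certificate (THETA-CERT-cc6 §E; HOME/cc-s2-1/gen22/TIER2-KERNEL-SPEC.md; soundness chain
`ThetaTier2Check … ThetaTier2RowSound`): the rows `(q, q⁺, m, δ·10¹², menu, k)` — `m = 5`, `δ = ⌊0.98·δ_q·10¹²⌋/10¹²` with
`δ_q = ½ log(q⁺/q)`, menu `0` = thin seed `(1/20, 19/20, 1)`, `η′ = 1/100` (menu `1` = `(1/4, 3/5, 1)`, `η′ = 1/20` for `q = 179, 191`),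
`t₀ = 2⁻¹⁵`; `K = 6`, `τ = 1/100`, `D = 3`, `W_l = 4`, `J = 64` — for the twin primes `5849 ≤ q ≤ 6761` in the range of the route item
`stmt-RiemannHypothesis-19172` (`WallsTenKTwin`, `route-RiemannHypothesis-WeilSemilocal`), checked in the kernel by `Row2.check`
(`decide +kernel`, ≈ 14 s per row), and the resulting REAL statements `T2Valid r.inp r.real ∧ r.RowFacts` (`Row2.check_sound`) that the
E-side assembly turns into `UC(q)`.  Nothing here bears on the truth of RH.
-/

set_option linter.dupNamespace false  -- the mandated namespace repeats `RiemannHypothesis`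

namespace Summit.RiemannHypothesis.RiemannHypothesis.Theorems.ThetaTier2

/-- Twin rows `5849 ≤ q ≤ 6299` (8 rows). [this cell, TIER2-KERNEL-SPEC §4] -/
def twinRows09_1 : List Row2 := [
  ⟨5849, 5851, 5, 167521369, 0, 15⟩, ⟨5867, 5869, 5, 167007499, 0, 15⟩, ⟨5879, 5881, 5, 166666668, 0, 15⟩, ⟨6089, 6091, 5, 160919541, 0, 15⟩,
  ⟨6131, 6133, 5, 159817353, 0, 15⟩, ⟨6197, 6199, 5, 158115522, 0, 15⟩, ⟨6269, 6271, 5, 156299841, 0, 15⟩, ⟨6299, 6301, 5, 155555556, 0, 15⟩ ]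

/-- The kernel verdict for `twinRows09_1`. [this cell, THETA-CERT-cc6 §E6] -/
theorem twinRows09_1_check : twinRows09_1.all Row2.check = true := by
  decide +kernel

/-- (K1)–(K7) and the row facts at every row of `twinRows09_1`. [this cell, THETA-CERT-cc6 §E6] -/
theorem twinRows09_1_valid : ∀ r ∈ twinRows09_1, T2Valid r.inp r.real ∧ r.RowFacts :=
  fun r hr => r.check_sound (List.all_eq_true.1 twinRows09_1_check r hr)

/-- Twin rows `6359 ≤ q ≤ 6761` (8 rows). [this cell, TIER2-KERNEL-SPEC §4] -/
def twinRows09_2 : List Row2 := [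
  ⟨6359, 6361, 5, 154088051, 0, 15⟩, ⟨6449, 6451, 5, 151937985, 0, 15⟩, ⟨6551, 6553, 5, 149572650, 0, 15⟩, ⟨6569, 6571, 5, 149162862, 0, 15⟩,
  ⟨6659, 6661, 5, 147147148, 0, 15⟩, ⟨6689, 6691, 5, 146487295, 0, 15⟩, ⟨6701, 6703, 5, 146225008, 0, 15⟩, ⟨6761, 6763, 5, 144927537, 0, 15⟩ ]

/-- The kernel verdict for `twinRows09_2`. [this cell, THETA-CERT-cc6 §E6] -/
theorem twinRows09_2_check : twinRows09_2.all Row2.check = true := by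
  decide +kernel

/-- (K1)–(K7) and the row facts at every row of `twinRows09_2`. [this cell, THETA-CERT-cc6 §E6] -/
theorem twinRows09_2_valid : ∀ r ∈ twinRows09_2, T2Valid r.inp r.real ∧ r.RowFacts :=
  fun r hr => r.check_sound (List.all_eq_true.1 twinRows09_2_check r hr)

end Summit.RiemannHypothesis.RiemannHypothesis.Theorems.ThetaTier2
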